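import Literature.Analysis.FluidPDE.SereginZajaczkowski2007L42Meridian
import Literature.Analysis.FluidPDE.ClassicalSuitable
import HarnessLib

/-!
# Seregin–Zajaczkowski 2007, (4.15): local calculus of the swirl and slice-wise integration by parts

G. Seregin, W. Zajaczkowski, *A sufficient condition of regularity for axially symmetric
solutions to the Navier–Stokes equations*, SIAM J. Math. Anal. 39 (2007) 669–685 =
arXiv:math/0702720, §4, proof of Lemma 4.3, (4.15) (the swirl equation). Support file
(everything proved; no definitions, no named facts) for the discharge of the named fact
`SereginZajaczkowski2007.SwirlEquation`: the hypothesis class `IsSmoothAxisymmetricSolutionOn S V P`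
of Prop. 4.1 is smooth in `x` only AT THE POINTS of the open set `S` and axially symmetric only
there, so the tree's global identities for the swirl `Γ = x₀u₁ - x₁u₀`
(`laplacian_swirl`, `IsAxisymmetric.partialDeriv_eR_swirl`, `SwirlTransportProofs`) are localised
here, and the regularity of `Γ(V)` and of its first two spatial derivatives as functions of
space–time on `S` is recorded. Contents:

* `exists_contDiff_eventuallyEq_of_contDiffAt`: a field `C^∞` at `x` agrees near `x` with a
  globally `C²` field (cut off with a bump) — the device localising global `C²` identities;
* `laplacian_swirl_of_contDiffAt` (`ΔΓ = ⟪Jx, Δu⟫ + 2(∂₀u₁ - ∂₁u₀)` at a point of smoothness),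
  `fderiv_fderiv_swirl_apply_of_contDiffAt` (`∂ₑ∂ₑΓ = ⟪Jx, D²u(e,e)⟫ + 2⟪Je, Du e⟫`),
  `partialDeriv_eR_swirl_of_mem` (`∂ᵣΓ = r(∂₀u₁ - ∂₁u₀)` from axial symmetry at the points of a
  set, via the tree's local infinitesimal symmetry `fderiv_rotGen_of_mem`);
* for the class: continuity on `S` of `Γ(V)`, `∂ₑΓ(V)`, `∂ₑ∂ₑΓ(V)` and of the components of `V`,
  `DV` in space–time, and differentiability of the slices;
* `integral_mul_fderiv_slice_eq_neg`: **slice-wise integration by parts in space–time**: for a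
  scalar `g` continuous on an open `U ⊆ ℝ × ℝ³`, differentiable in `x` at the points of `U` with
  `∂ᵥg` continuous on `U`, and a space–time test function `φ` on `U`,
  `∫∫ g ∂ᵥφ = -∫∫ (∂ᵥg) φ` (Fubini and Mathlib's
  `integral_mul_fderiv_eq_neg_fderiv_mul_of_integrable` on each time slice; no time regularity of
  `g` is involved) — the scalar twin of the parent file's `hasWeakSpatialGradientOn_fderiv`.

## References

* G. Seregin, W. Zajaczkowski, SIAM J. Math. Anal. 39 (2007) 669–685, arXiv:math/0702720, §4
  proof of Lemma 4.3, (4.15). [`SereginZajaczkowski2007`]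
* L. C. Evans, *Partial Differential Equations*, 2nd ed. (2010), §5.2.1 (weak derivatives),
  App. C.2 (integration by parts).
-/

noncomputable section

open MeasureTheory Set Function Filter Topology TopologicalSpace Metric WithLp
open scoped NNReal ENNReal ContDiff InnerProductSpace RealInnerProductSpace Laplacian

namespace Literature.Analysis.FluidPDE

namespace SereginZajaczkowski2007

open SereginSverak2009

/-! ### Localising global `C²` identities -/

section Local

variable {F : Type*} [NormedAddCommGroup F] [NormedSpace ℝ F]

/-- **Smooth cut-off extension.** A field which is `C^∞` at `x` agrees, on a neighbourhood of `x`,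
with a globally `C²` field (multiply by a bump centred at `x` supported where the field is `C²`).
[folklore] -/
theorem exists_contDiff_eventuallyEq_of_contDiffAt {u : (EuclideanSpace ℝ (Fin 3)) → F} {x : (EuclideanSpace ℝ (Fin 3))}
    (hu : ContDiffAt ℝ ∞ u x) : ∃ w : (EuclideanSpace ℝ (Fin 3)) → F, ContDiff ℝ 2 w ∧ w =ᶠ[𝓝 x] u := by
  obtain ⟨U, hU, hUc⟩ := hu.contDiffOn (m := 2) (by norm_cast) (by intro h; exact absurd h (by decide))
  obtain ⟨ρ, hρ, hball⟩ := Metric.mem_nhds_iff.1 hU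
  let χ : ContDiffBump x := ⟨ρ / 4, ρ / 2, by positivity, by linarith⟩
  refine ⟨fun y => χ y • u y, ?_, ?_⟩
  · rw [contDiff_iff_contDiffAt]
    intro y
    by_cases hy : y ∈ ball x ρ
    · exact χ.contDiff.contDiffAt.smul
        (hUc.contDiffAt (Filter.mem_of_superset (isOpen_ball.mem_nhds hy) hball))
    · have hy' : y ∉ tsupport (χ : (EuclideanSpace ℝ (Fin 3)) → ℝ) := by
        rw [χ.tsupport_eq]
        intro h
        apply hy
        have h' : dist y x ≤ ρ / 2 := mem_closedBall.1 h
        exact mem_ball.2 (by linarith)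
      have h0 : (fun y => χ y • u y) =ᶠ[𝓝 y] fun _ => (0 : F) := by
        filter_upwards [notMem_tsupport_iff_eventuallyEq.1 hy'] with y' hy''
        rw [hy'', Pi.zero_apply, zero_smul]
      exact (contDiffAt_const (c := (0 : F))).congr_of_eventuallyEq h0
  · filter_upwards [Metric.ball_mem_nhds x (by positivity : (0 : ℝ) < ρ / 4)] with y hy
    rw [χ.one_of_mem_closedBall (mem_closedBall.2 (mem_ball.1 hy).le), one_smul]

/-- **Second derivatives of the swirl of a `C²` field**: for `u ∈ C²` and any vector `e`,
`∂ₑ∂ₑΓ(x) = ⟪Jx, D²u(x)(e, e)⟫ + 2⟪Je, Du(x)e⟫` (Leibniz rule for `Γ = ⟪J·, u⟫`, `J` linear).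
[folklore] -/
theorem fderiv_fderiv_swirl_apply {u : (EuclideanSpace ℝ (Fin 3)) → (EuclideanSpace ℝ (Fin 3))} (hu : ContDiff ℝ 2 u) (x e : (EuclideanSpace ℝ (Fin 3))) :
    fderiv ℝ (fun y => fderiv ℝ (swirl u) y e) x e =
      ⟪rotGen x, iteratedFDeriv ℝ 2 u x ![e, e]⟫ + 2 * ⟪rotGen e, fderiv ℝ u x e⟫ := by
  have hu1 : Differentiable ℝ u := (hu.of_le one_le_two).differentiable one_ne_zero
  have hDi : Differentiable ℝ fun y => fderiv ℝ u y e :=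
    ((hu.fderiv_right (m := 1) le_rfl).clm_apply contDiff_const).differentiable one_ne_zero
  have h1 : (fun y => fderiv ℝ (swirl u) y e) =
      fun y => ⟪rotGen y, fderiv ℝ u y e⟫ + ⟪rotGen e, u y⟫ :=
    funext fun y => fderiv_swirl_apply (hu1 y) e
  rw [h1, fderiv_fun_add (((hasFDerivAt_rotGen x).differentiableAt).inner ℝ (hDi x))
    ((differentiableAt_const _).inner ℝ (hu1 x))]
  rw [_root_.add_apply,
    fderiv_inner_apply ℝ (hasFDerivAt_rotGen x).differentiableAt (hDi x),
    fderiv_inner_apply ℝ (differentiableAt_const _) (hu1 x), (hasFDerivAt_rotGen x).fderiv,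
    fderiv_const_apply, fderiv_fderiv_apply_const hu x e]
  simp only [rotGenL_apply, _root_.zero_apply, inner_zero_left, add_zero]
  ring

/-- **Laplacian of the swirl, local form**: if `u` is `C^∞` at `x`, then
`ΔΓ(x) = ⟪Jx, Δu(x)⟫ + 2(∂₀u₁ - ∂₁u₀)(x)` (the tree's `laplacian_swirl` for the globally `C²`
cut-off extension, transported by the locality of `Δ` and `D`). [folklore] -/
theorem laplacian_swirl_of_contDiffAt {u : (EuclideanSpace ℝ (Fin 3)) → (EuclideanSpace ℝ (Fin 3))} {x : (EuclideanSpace ℝ (Fin 3))} (hu : ContDiffAt ℝ ∞ u x) :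
    (Δ (swirl u)) x = ⟪rotGen x, (Δ u) x⟫ +
      2 * (fderiv ℝ u x (EuclideanSpace.single 0 1) 1 - fderiv ℝ u x (EuclideanSpace.single 1 1) 0) := by
  obtain ⟨w, hw, hwu⟩ := exists_contDiff_eventuallyEq_of_contDiffAt hu
  have hsw : swirl w =ᶠ[𝓝 x] swirl u := hwu.mono fun y hy => by simp only [swirl, hy]
  rw [← (InnerProductSpace.laplacian_congr_nhds hsw).self_of_nhds,
    ← (InnerProductSpace.laplacian_congr_nhds hwu).self_of_nhds, ← hwu.fderiv_eq,
    laplacian_swirl hw x]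

/-- **Second derivatives of the swirl, local form**: if `u` is `C^∞` at `x`, then for any `e`,
`∂ₑ∂ₑΓ(x) = ⟪Jx, D²u(x)(e, e)⟫ + 2⟪Je, Du(x)e⟫`. [folklore] -/
theorem fderiv_fderiv_swirl_apply_of_contDiffAt {u : (EuclideanSpace ℝ (Fin 3)) → (EuclideanSpace ℝ (Fin 3))} {x : (EuclideanSpace ℝ (Fin 3))} (hu : ContDiffAt ℝ ∞ u x)
    (e : (EuclideanSpace ℝ (Fin 3))) :
    fderiv ℝ (fun y => fderiv ℝ (swirl u) y e) x e =
      ⟪rotGen x, iteratedFDeriv ℝ 2 u x ![e, e]⟫ + 2 * ⟪rotGen e, fderiv ℝ u x e⟫ := by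
  obtain ⟨w, hw, hwu⟩ := exists_contDiff_eventuallyEq_of_contDiffAt hu
  have hsw : swirl w =ᶠ[𝓝 x] swirl u := hwu.mono fun y hy => by simp only [swirl, hy]
  have h1 : (fun y => fderiv ℝ (swirl w) y e) =ᶠ[𝓝 x] fun y => fderiv ℝ (swirl u) y e :=
    (hsw.fderiv (𝕜 := ℝ)).mono fun y hy => by
      show fderiv ℝ (swirl w) y e = fderiv ℝ (swirl u) y e
      rw [hy]
  rw [← h1.fderiv_eq, ← (hwu.iteratedFDeriv ℝ 2).self_of_nhds, ← hwu.fderiv_eq,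
    fderiv_fderiv_swirl_apply hw x e]

/-- **Radial derivative of the swirl, local form**: if `u (R_θ y) = R_θ (u y)` for all `θ` at the
points of a set `U` and `u` is differentiable at `x ∈ U`, then `∂ᵣΓ(x) = r (∂₀u₁ - ∂₁u₀)(x)`,
`∂ᵣ` the derivative along `eR x` (the tree's `IsAxisymmetric.partialDeriv_eR_swirl`, with the
local infinitesimal symmetry `fderiv_rotGen_of_mem`). [folklore] -/
theorem partialDeriv_eR_swirl_of_mem {U : Set (EuclideanSpace ℝ (Fin 3))} {u : (EuclideanSpace ℝ (Fin 3)) → (EuclideanSpace ℝ (Fin 3))}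
    (hu : ∀ θ : ℝ, ∀ y ∈ U, u (rotZ θ y) = rotZ θ (u y)) {x : (EuclideanSpace ℝ (Fin 3))} (hx : x ∈ U)
    (hd : DifferentiableAt ℝ u x) :
    partialDeriv (eR x) (swirl u) x = cylRadius x *
      (fderiv ℝ u x (EuclideanSpace.single 0 1) 1 - fderiv ℝ u x (EuclideanSpace.single 1 1) 0) := by
  -- the infinitesimal axisymmetry relations at `x`
  have hJ := fderiv_rotGen_of_mem hu hx hd
  rw [rotGen_eq_sub_single, map_sub, map_smul, map_smul] at hJ
  have hA := congrArg (fun v : (EuclideanSpace ℝ (Fin 3)) => v 0) hJ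
  have hB := congrArg (fun v : (EuclideanSpace ℝ (Fin 3)) => v 1) hJ
  simp only [PiLp.sub_apply, PiLp.smul_apply, smul_eq_mul, rotGen_apply_zero,
    rotGen_apply_one] at hA hB
  -- the horizontal derivative
  have hh : fderiv ℝ (swirl u) x (toLp 2 ![x 0, x 1, 0]) = cylRadius x ^ 2 *
      (fderiv ℝ u x (EuclideanSpace.single 0 1) 1 - fderiv ℝ u x (EuclideanSpace.single 1 1) 0) := by
    rw [fderiv_swirl_apply hd, toLp_horizontal_eq_add_single, map_add, map_smul, map_smul,
      rotGen_add, rotGen_smul, rotGen_smul, rotGen_single_zero, rotGen_single_one,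
      inner_rotGen_left, cylRadius_sq]
    simp only [PiLp.add_apply, PiLp.smul_apply, smul_eq_mul, inner_add_left, inner_smul_left,
      inner_neg_left, EuclideanSpace.inner_single_left, map_one, one_mul, RCLike.conj_to_real]
    linear_combination x 0 * hA + x 1 * hB
  rw [partialDeriv_apply, eR, map_smul, hh, smul_eq_mul]
  by_cases hx0 : cylRadius x = 0
  · simp [hx0]
  · rw [← mul_assoc, pow_two, ← mul_assoc, inv_mul_cancel₀ hx0, one_mul]

end Local

/-! ### The swirl of the smooth class and its derivatives, as functions of space–time -/

namespace IsSmoothAxisymmetricSolutionOn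

variable {S : Opens (ℝ × (EuclideanSpace ℝ (Fin 3)))} {V : ℝ → (EuclideanSpace ℝ (Fin 3)) → (EuclideanSpace ℝ (Fin 3))} {P : ℝ → (EuclideanSpace ℝ (Fin 3)) → ℝ}

/-- The slices `Γ(V(t, ·))` are `C^∞` at the points of `S`. [folklore] -/
theorem contDiffAt_swirl (h : IsSmoothAxisymmetricSolutionOn S V P) {z : ℝ × (EuclideanSpace ℝ (Fin 3))}
    (hz : z ∈ (S : Set (ℝ × (EuclideanSpace ℝ (Fin 3))))) : ContDiffAt ℝ ∞ (swirl (V z.1)) z.2 := by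
  rw [swirl_eq_inner_rotGen]
  exact rotGenL.contDiff.contDiffAt.inner ℝ (h.contDiffAt z hz)

/-- `Γ(V)` is continuous on `S` in space–time. [folklore] -/
theorem continuousOn_swirl (h : IsSmoothAxisymmetricSolutionOn S V P) :
    ContinuousOn (fun z : ℝ × (EuclideanSpace ℝ (Fin 3)) => swirl (V z.1) z.2) (S : Set (ℝ × (EuclideanSpace ℝ (Fin 3)))) := by
  have hc : ContinuousOn (fun z : ℝ × (EuclideanSpace ℝ (Fin 3)) => ⟪rotGen z.2, V z.1 z.2⟫) (S : Set (ℝ × (EuclideanSpace ℝ (Fin 3)))) :=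
    ((rotGenL.continuous.comp continuous_snd).continuousOn).inner h.continuousOn_velocity
  refine hc.congr fun z _ => ?_
  simp only [swirl_eq_inner_rotGen]

/-- `∂ₑΓ(V)` is continuous on `S` in space–time (`DΓ e = ⟪Jx, DV e⟫ + ⟪Je, V⟫`). [folklore] -/
theorem continuousOn_fderiv_swirl_apply (h : IsSmoothAxisymmetricSolutionOn S V P) (e : (EuclideanSpace ℝ (Fin 3))) :
    ContinuousOn (fun z : ℝ × (EuclideanSpace ℝ (Fin 3)) => fderiv ℝ (swirl (V z.1)) z.2 e) (S : Set (ℝ × (EuclideanSpace ℝ (Fin 3)))) := by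
  have hc : ContinuousOn (fun z : ℝ × (EuclideanSpace ℝ (Fin 3)) => ⟪rotGen z.2, fderiv ℝ (V z.1) z.2 e⟫ + ⟪rotGen e, V z.1 z.2⟫)
      (S : Set (ℝ × (EuclideanSpace ℝ (Fin 3)))) :=
    (((rotGenL.continuous.comp continuous_snd).continuousOn).inner
      (h.continuousOn_fderiv.clm_apply continuousOn_const)).add
      (continuousOn_const.inner h.continuousOn_velocity)
  exact hc.congr fun z hz => fderiv_swirl_apply (h.differentiableAt hz) e

/-- The slice derivative `y ↦ ∂ₑΓ(V(t, ·))(y)` is differentiable at the points of `S`. [folklore] -/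
theorem differentiableAt_fderiv_swirl_apply (h : IsSmoothAxisymmetricSolutionOn S V P) (e : (EuclideanSpace ℝ (Fin 3)))
    {z : ℝ × (EuclideanSpace ℝ (Fin 3))} (hz : z ∈ (S : Set (ℝ × (EuclideanSpace ℝ (Fin 3))))) :
    DifferentiableAt ℝ (fun y => fderiv ℝ (swirl (V z.1)) y e) z.2 := by
  have hD : DifferentiableAt ℝ (fderiv ℝ (swirl (V z.1))) z.2 :=
    ((h.contDiffAt_swirl hz).fderiv_right (m := 1) (by norm_cast)).differentiableAt one_ne_zero
  exact hD.clm_apply (differentiableAt_const e)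

/-- `∂ₑ∂ₑΓ(V)` is continuous on `S` in space–time (`= ⟪Jx, D²V(e,e)⟫ + 2⟪Je, DV e⟫`; all spatial
derivatives of `V` are continuous on `S`). [folklore] -/
theorem continuousOn_fderiv_fderiv_swirl_apply (h : IsSmoothAxisymmetricSolutionOn S V P)
    (e : (EuclideanSpace ℝ (Fin 3))) :
    ContinuousOn (fun z : ℝ × (EuclideanSpace ℝ (Fin 3)) => fderiv ℝ (fun y => fderiv ℝ (swirl (V z.1)) y e) z.2 e)
      (S : Set (ℝ × (EuclideanSpace ℝ (Fin 3)))) := by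
  have h2 : ContinuousOn (fun z : ℝ × (EuclideanSpace ℝ (Fin 3)) => iteratedFDeriv ℝ 2 (V z.1) z.2 ![e, e])
      (S : Set (ℝ × (EuclideanSpace ℝ (Fin 3)))) :=
    (continuous_eval_const (![e, e] : Fin 2 → (EuclideanSpace ℝ (Fin 3)))).comp_continuousOn (h.continuousOn_iteratedFDeriv 2)
  have hc : ContinuousOn (fun z : ℝ × (EuclideanSpace ℝ (Fin 3)) =>
      ⟪rotGen z.2, iteratedFDeriv ℝ 2 (V z.1) z.2 ![e, e]⟫ + 2 * ⟪rotGen e, fderiv ℝ (V z.1) z.2 e⟫)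
      (S : Set (ℝ × (EuclideanSpace ℝ (Fin 3)))) :=
    (((rotGenL.continuous.comp continuous_snd).continuousOn).inner h2).add
      (continuousOn_const.mul (continuousOn_const.inner (h.continuousOn_fderiv.clm_apply continuousOn_const)))
  exact hc.congr fun z hz => fderiv_fderiv_swirl_apply_of_contDiffAt (h.contDiffAt z hz) e

/-- The components `⟪V, c⟫` are continuous on `S`. [folklore] -/
theorem continuousOn_inner_const (h : IsSmoothAxisymmetricSolutionOn S V P) (c : (EuclideanSpace ℝ (Fin 3))) :
    ContinuousOn (fun z : ℝ × (EuclideanSpace ℝ (Fin 3)) => ⟪V z.1 z.2, c⟫) (S : Set (ℝ × (EuclideanSpace ℝ (Fin 3)))) :=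
  h.continuousOn_velocity.inner continuousOn_const

/-- The components `⟪DV e, c⟫` are continuous on `S`. [folklore] -/
theorem continuousOn_inner_fderiv_const (h : IsSmoothAxisymmetricSolutionOn S V P) (e c : (EuclideanSpace ℝ (Fin 3))) :
    ContinuousOn (fun z : ℝ × (EuclideanSpace ℝ (Fin 3)) => ⟪fderiv ℝ (V z.1) z.2 e, c⟫) (S : Set (ℝ × (EuclideanSpace ℝ (Fin 3)))) :=
  (h.continuousOn_fderiv.clm_apply continuousOn_const).inner continuousOn_const

/-- `∂ₑ⟪V, c⟫ = ⟪DV e, c⟫` at the points of `S`. [folklore] -/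
theorem fderiv_inner_const_apply (h : IsSmoothAxisymmetricSolutionOn S V P) {z : ℝ × (EuclideanSpace ℝ (Fin 3))}
    (hz : z ∈ (S : Set (ℝ × (EuclideanSpace ℝ (Fin 3))))) (e c : (EuclideanSpace ℝ (Fin 3))) :
    fderiv ℝ (fun y => ⟪V z.1 y, c⟫) z.2 e = ⟪fderiv ℝ (V z.1) z.2 e, c⟫ := by
  rw [fderiv_inner_apply ℝ (h.differentiableAt hz) (differentiableAt_const c), fderiv_const_apply]
  simp

/-- `∂ₑ⟪J V, c⟫ = ⟪J (DV e), c⟫` at the points of `S` (`J` is linear). [folklore] -/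
theorem fderiv_inner_rotGen_const_apply (h : IsSmoothAxisymmetricSolutionOn S V P) {z : ℝ × (EuclideanSpace ℝ (Fin 3))}
    (hz : z ∈ (S : Set (ℝ × (EuclideanSpace ℝ (Fin 3))))) (e c : (EuclideanSpace ℝ (Fin 3))) :
    fderiv ℝ (fun y => ⟪rotGen (V z.1 y), c⟫) z.2 e = ⟪rotGen (fderiv ℝ (V z.1) z.2 e), c⟫ := by
  have hJV : HasFDerivAt (fun y => rotGen (V z.1 y)) (rotGenL.comp (fderiv ℝ (V z.1) z.2)) z.2 :=
    rotGenL.hasFDerivAt.comp z.2 (h.differentiableAt hz).hasFDerivAt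
  rw [fderiv_inner_apply ℝ hJV.differentiableAt (differentiableAt_const c), fderiv_const_apply,
    hJV.fderiv]
  simp

/-- The slices `y ↦ ⟪J V(t, y), c⟫` are differentiable at the points of `S`. [folklore] -/
theorem differentiableAt_inner_rotGen_const (h : IsSmoothAxisymmetricSolutionOn S V P)
    {z : ℝ × (EuclideanSpace ℝ (Fin 3))} (hz : z ∈ (S : Set (ℝ × (EuclideanSpace ℝ (Fin 3))))) (c : (EuclideanSpace ℝ (Fin 3))) :
    DifferentiableAt ℝ (fun y => ⟪rotGen (V z.1 y), c⟫) z.2 :=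
  ((rotGenL.hasFDerivAt.comp z.2 (h.differentiableAt hz).hasFDerivAt).differentiableAt).inner ℝ
    (differentiableAt_const c)

end IsSmoothAxisymmetricSolutionOn

/-! ### Slice-wise integration by parts in space–time -/

section IBP

variable {U : Opens (ℝ × (EuclideanSpace ℝ (Fin 3)))}

/-- A product of a continuous factor supported in a compact subset of the open set `U` with a
factor continuous on `U` is integrable on `ℝ × ℝ³`. [folklore] -/
theorem integrable_mul_of_tsupport_subset {c g : ℝ × (EuclideanSpace ℝ (Fin 3)) → ℝ} (hc : Continuous c)
    (hcs : HasCompactSupport c) (hcU : tsupport c ⊆ (U : Set (ℝ × (EuclideanSpace ℝ (Fin 3)))))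
    (hg : ContinuousOn g (U : Set (ℝ × (EuclideanSpace ℝ (Fin 3))))) : Integrable (fun z => c z * g z) := by
  exact (continuous_mul_of_tsupport_subset' U.isOpen hc hcU hg).integrable_of_hasCompactSupport
    hcs.mul_right

/-- The slice derivative `(t, x) ↦ ∂ᵥφ(t, ·)(x)` of a space–time test function is a space–time
test function on the same set. [folklore] -/
theorem isSpaceTimeTestOn_fderiv_apply {φ : ℝ → (EuclideanSpace ℝ (Fin 3)) → ℝ} (hφ : IsSpaceTimeTestOn U φ) (v : (EuclideanSpace ℝ (Fin 3))) :
    IsSpaceTimeTestOn U (fun t x => fderiv ℝ (φ t) x v) := by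
  have hd : Differentiable ℝ (uncurry φ) := hφ.contDiff.differentiable (by simp)
  -- slices: `D(φ t)(x) v = D(uncurry φ)(t, x)(0, v)`
  have hslice : ∀ (t : ℝ) (x : (EuclideanSpace ℝ (Fin 3))), fderiv ℝ (φ t) x v = fderiv ℝ (uncurry φ) (t, x) ((0 : ℝ), v) := by
    intro t x
    have h1 : HasFDerivAt (fun y : (EuclideanSpace ℝ (Fin 3)) => ((t, y) : ℝ × (EuclideanSpace ℝ (Fin 3)))) (ContinuousLinearMap.inr ℝ ℝ (EuclideanSpace ℝ (Fin 3))) x :=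
      hasFDerivAt_prodMk_right t x
    have h2 := ((hd (t, x)).hasFDerivAt).comp x h1
    rw [show φ t = uncurry φ ∘ fun y : (EuclideanSpace ℝ (Fin 3)) => ((t, y) : ℝ × (EuclideanSpace ℝ (Fin 3))) from rfl, h2.fderiv]
    rfl
  have heq : uncurry (fun t x => fderiv ℝ (φ t) x v) =
      fun z : ℝ × (EuclideanSpace ℝ (Fin 3)) => fderiv ℝ (uncurry φ) z ((0 : ℝ), v) := by
    funext z
    exact hslice z.1 z.2
  refine ⟨?_, ?_, ?_⟩
  · rw [heq]
    exact (hφ.contDiff.fderiv_right (m := ∞) (by norm_cast)).clm_apply contDiff_const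
  · rw [heq]
    exact hφ.hasCompactSupport.fderiv_apply (𝕜 := ℝ) _
  · rw [heq]
    exact (tsupport_fderiv_apply_subset ℝ _).trans hφ.tsupport_subset

/-- **Slice-wise integration by parts in space–time.** Let `U ⊆ ℝ × ℝ³` be open, `g : ℝ × ℝ³ → ℝ`
continuous on `U`, differentiable in `x` at the points of `U`, with `(t, x) ↦ ∂ᵥg(t, ·)(x)`
continuous on `U`, and let `φ` be a space–time test function on `U`. Then
`∫∫ g ∂ᵥφ dx dt = -∫∫ (∂ᵥg) φ dx dt` (integrals over `ℝ × ℝ³`; both integrands are continuous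
with compact support): Fubini, and on each time slice Mathlib's integration by parts
`integral_mul_fderiv_eq_neg_fderiv_mul_of_integrable`, which only needs differentiability on the
supports (Evans, *PDE*, §5.2.1, App. C.2). No regularity of `g` in `t` is used. [folklore] -/
theorem integral_mul_fderiv_slice_eq_neg {g : ℝ × (EuclideanSpace ℝ (Fin 3)) → ℝ} {φ : ℝ → (EuclideanSpace ℝ (Fin 3)) → ℝ} {v : (EuclideanSpace ℝ (Fin 3))}
    (hg0 : ContinuousOn g (U : Set (ℝ × (EuclideanSpace ℝ (Fin 3)))))
    (hgd : ∀ z ∈ (U : Set (ℝ × (EuclideanSpace ℝ (Fin 3)))), DifferentiableAt ℝ (fun y => g (z.1, y)) z.2)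
    (hg1 : ContinuousOn (fun z : ℝ × (EuclideanSpace ℝ (Fin 3)) => fderiv ℝ (fun y => g (z.1, y)) z.2 v) (U : Set (ℝ × (EuclideanSpace ℝ (Fin 3)))))
    (hφ : IsSpaceTimeTestOn U φ) :
    ∫ z : ℝ × (EuclideanSpace ℝ (Fin 3)), g z * fderiv ℝ (φ z.1) z.2 v =
      -∫ z : ℝ × (EuclideanSpace ℝ (Fin 3)), fderiv ℝ (fun y => g (z.1, y)) z.2 v * φ z.1 z.2 := by
  have hφ' := isSpaceTimeTestOn_fderiv_apply hφ v
  -- the two space–time integrands are continuous with compact support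
  set A : ℝ × (EuclideanSpace ℝ (Fin 3)) → ℝ := fun z => fderiv ℝ (φ z.1) z.2 v * g z with hA
  set B : ℝ × (EuclideanSpace ℝ (Fin 3)) → ℝ := fun z => φ z.1 z.2 * fderiv ℝ (fun y => g (z.1, y)) z.2 v with hB
  have hAi : Integrable A :=
    integrable_mul_of_tsupport_subset hφ'.contDiff.continuous hφ'.hasCompactSupport
      hφ'.tsupport_subset hg0
  have hBi : Integrable B :=
    integrable_mul_of_tsupport_subset hφ.contDiff.continuous hφ.hasCompactSupport
      hφ.tsupport_subset hg1
  have hFubA : ∫ z, A z = ∫ t, ∫ x, A (t, x) := by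
    rw [Measure.volume_eq_prod]
    exact integral_prod A ((Measure.volume_eq_prod (ℝ) ((EuclideanSpace ℝ (Fin 3)))) ▸ hAi)
  have hFubB : ∫ z, B z = ∫ t, ∫ x, B (t, x) := by
    rw [Measure.volume_eq_prod]
    exact integral_prod B ((Measure.volume_eq_prod (ℝ) ((EuclideanSpace ℝ (Fin 3)))) ▸ hBi)
  -- slice by slice
  have hslice : ∀ t : ℝ, ∫ x, A (t, x) = -∫ x, B (t, x) := by
    intro t
    set Ut : Set (EuclideanSpace ℝ (Fin 3)) := {x | (t, x) ∈ (U : Set (ℝ × (EuclideanSpace ℝ (Fin 3))))} with hUt_def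
    have hmk : Continuous fun x : (EuclideanSpace ℝ (Fin 3)) => ((t, x) : ℝ × (EuclideanSpace ℝ (Fin 3))) := continuous_const.prodMk continuous_id
    have hUt : IsOpen Ut := U.isOpen.preimage hmk
    -- the slice of the test function
    have hcpt : HasCompactSupport (φ t) := hφ.hasCompactSupport_slice t
    have hsubU : tsupport (φ t) ⊆ Ut := fun x hx => by
      by_contra h
      exact (notMem_tsupport_slice_of_notMem (fun h' => h (hφ.tsupport_subset h'))) hx
    have hφd : Differentiable ℝ (φ t) := (hφ.contDiff_slice t).differentiable (by simp)
    have hφc : Continuous (φ t) := (hφ.contDiff_slice t).continuous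
    have hφ'c : Continuous fun x => fderiv ℝ (φ t) x v := (hφ'.contDiff_slice t).continuous
    have hφ's : tsupport (fun x => fderiv ℝ (φ t) x v) ⊆ Ut :=
      (tsupport_fderiv_apply_subset ℝ v).trans hsubU
    -- the slice of `g`
    set f : (EuclideanSpace ℝ (Fin 3)) → ℝ := fun y => g (t, y) with hf_def
    have hfc : ContinuousOn f Ut := fun x hx =>
      (hg0.continuousAt (U.isOpen.mem_nhds hx)).comp_continuousWithinAt
        (hmk.continuousWithinAt : ContinuousWithinAt _ Ut x)
    have hf'c : ContinuousOn (fun x => fderiv ℝ f x v) Ut := fun x hx =>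
      (hg1.continuousAt (U.isOpen.mem_nhds hx)).comp_continuousWithinAt
        (hmk.continuousWithinAt : ContinuousWithinAt _ Ut x)
    have hfd : ∀ x ∈ Ut, DifferentiableAt ℝ f x := fun x hx => hgd (t, x) hx
    -- integrability of the three products
    have i1 : Integrable (fun x => fderiv ℝ f x v * φ t x) := by
      have h : Integrable (fun x => φ t x * fderiv ℝ f x v) :=
        (continuous_mul_of_tsupport_subset' hUt hφc hsubU hf'c).integrable_of_hasCompactSupport
          hcpt.mul_right
      exact h.congr (Eventually.of_forall fun x => mul_comm _ _)
    have i2 : Integrable (fun x => f x * fderiv ℝ (φ t) x v) := by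
      have h : Integrable (fun x => fderiv ℝ (φ t) x v * f x) :=
        (continuous_mul_of_tsupport_subset' hUt hφ'c hφ's hfc).integrable_of_hasCompactSupport
          ((hcpt.fderiv_apply (𝕜 := ℝ) v).mul_right)
      exact h.congr (Eventually.of_forall fun x => mul_comm _ _)
    have i3 : Integrable (fun x => f x * φ t x) := by
      have h : Integrable (fun x => φ t x * f x) :=
        (continuous_mul_of_tsupport_subset' hUt hφc hsubU hfc).integrable_of_hasCompactSupport
          hcpt.mul_right
      exact h.congr (Eventually.of_forall fun x => mul_comm _ _)
    have ibp := integral_mul_fderiv_eq_neg_fderiv_mul_of_integrable (μ := volume) i1 i2 i3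
      (fun x hx => hfd x (hsubU hx)) (fun x _ => hφd x)
    -- `∫ A(t, ·) = ∫ f ∂ᵥφ`, `∫ B(t, ·) = ∫ ∂ᵥf φ`
    have hAt : ∫ x, A (t, x) = ∫ x, f x * fderiv ℝ (φ t) x v :=
      integral_congr_ae (Eventually.of_forall fun x => mul_comm _ _)
    have hBt : ∫ x, B (t, x) = ∫ x, fderiv ℝ f x v * φ t x :=
      integral_congr_ae (Eventually.of_forall fun x => mul_comm _ _)
    rw [hAt, hBt, ibp]
  calc ∫ z : ℝ × (EuclideanSpace ℝ (Fin 3)), g z * fderiv ℝ (φ z.1) z.2 v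
      = ∫ z, A z := integral_congr_ae (Eventually.of_forall fun z => mul_comm _ _)
    _ = ∫ t, ∫ x, A (t, x) := hFubA
    _ = ∫ t, -∫ x, B (t, x) := integral_congr_ae (Eventually.of_forall hslice)
    _ = -∫ t, ∫ x, B (t, x) := integral_neg (μ := volume) fun t => ∫ x, B (t, x)
    _ = -∫ z, B z := by rw [hFubB]
    _ = -∫ z : ℝ × (EuclideanSpace ℝ (Fin 3)), fderiv ℝ (fun y => g (z.1, y)) z.2 v * φ z.1 z.2 := by
        congr 1
        exact integral_congr_ae (Eventually.of_forall fun z => mul_comm (φ z.1 z.2) _)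

end IBP

end SereginZajaczkowski2007

end Literature.Analysis.FluidPDE
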